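import Summits.CriticalPhenomena.PercolationContinuityZ3.Theorems.PercNearOneGluingNoHeavyLowerTailFrontierDecRowsLeFive

/-!
# `NoHeavyLowerTail` (crux stmt-CriticalPhenomena-4575), law-level frontier: the SPECTATOR-TRIANGLE quadratic row `F11y` and the 15-term row `Q44`
# hold on every weighted graph with at most five vertices — kernel-checked comb certificates (bounded-n base of a NEW quadratic row family)

Support file (prover seat `prim-bnk-1` gen 13; `--supports stmt-CriticalPhenomena-4575`; COMPUTATIONAL: four `checkC` evaluations use `native_decide`).

Context (memo run/shared/lean/prim/prim-l12/FROM-prim-bnk-1-gen13-COMB2-ROWS.md).  Write `μ(π)` for the probability that the open-cluster partition of the four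
marked points `a, b, c, y` is exactly `π`.  The quadratic rows
* `F11y`:  `μ(abc|y)·μ(a|b|c|y) ≥ μ(ab|c|y)μ(ac|b|y) + μ(ab|c|y)μ(a|bc|y) + μ(ac|b|y)μ(a|bc|y)`   (the three-terminal Gladkov–Zimin row
  `μ(abc)μ(a|b|c) ≥ Σ_pairs μ(ab|c)μ(ac|b)` read on the cells in which the spectator `y` is a singleton block), and
* `Q44` (15 terms, coefficients `1, −1, −½`; found as the optimal two-copy comb-positive cut at the row-44 pseudo-law of the sibling searches)
are two-copy comb positive on `K₄, K₅, K₆` (exact enumeration of all `3^15` fibres, prim-bnk-1 gen 13) and separate the known law-level pseudo-laws of the open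
frontier rows 44 and 15 from the realizable laws by margins `1e-4 … 7e-4`, which no previously catalogued family does.  Their all-`n` validity is OPEN (conjectured);
this file records the kernel-checked base: both rows hold for ALL edge weights on every graph with `≤ 5` vertices.  As cubic term families (third factor the sure
event) they pass prim-cert-2's three-copy checker `checkC` at `K₄` (base `2^23`) and `K₅` (base `2^35`), and `CombRows.quad_cval_le_five` transports the check to every
pairwise distinct quadruple.  NOTHING is claimed beyond five vertices.
-/

namespace Summit.CriticalPhenomena.PercolationContinuityZ3.Theorems.SpectatorTriangleRow

open Finset MeasureTheory OneCutCert CovTransferCert E3GroupSepCert CombRows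
open scoped BigOperators
open Literature.Probability.Percolation Literature.Probability.LatticeModels

variable {n : ℕ}

/-! ## Cell predicates of the partition lattice of `(a, b, c, y)` (as conjunctions of `lnk` / `sep`) -/

/-- `abc|y`: `a ~ b`, `a ~ c`, `y` cut from `a`. [this work] -/
def cABC_Y (a b c y : Fin n) : CRel n → Bool := pAnd (lnk [a] [b]) (pAnd (lnk [a] [c]) (sep [y] [a]))
/-- `a|b|c|y`: all four marked points pairwise separated. [this work] -/
def cNone (a b c y : Fin n) : CRel n → Bool := pAnd (sep [a] [b, c, y]) (pAnd (sep [b] [c, y]) (sep [c] [y]))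
/-- `ab|c|y`. [this work] -/
def cAB (a b c y : Fin n) : CRel n → Bool := pAnd (lnk [a] [b]) (pAnd (sep [a] [c, y]) (sep [c] [y]))
/-- `ac|b|y`. [this work] -/
def cAC (a b c y : Fin n) : CRel n → Bool := pAnd (lnk [a] [c]) (pAnd (sep [a] [b, y]) (sep [b] [y]))
/-- `a|bc|y`. [this work] -/
def cBC (a b c y : Fin n) : CRel n → Bool := pAnd (lnk [b] [c]) (pAnd (sep [a] [b, y]) (sep [b] [y]))
/-- `abcy`: all four connected. [this work] -/
def cAll (a b c y : Fin n) : CRel n → Bool := pAnd (lnk [a] [b]) (pAnd (lnk [a] [c]) (lnk [a] [y]))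
/-- `ab|cy`. [this work] -/
def cAB_CY (a b c y : Fin n) : CRel n → Bool := pAnd (lnk [a] [b]) (pAnd (lnk [c] [y]) (sep [a] [c]))
/-- `ac|by`. [this work] -/
def cAC_BY (a b c y : Fin n) : CRel n → Bool := pAnd (lnk [a] [c]) (pAnd (lnk [b] [y]) (sep [a] [b]))
/-- `ay|bc`. [this work] -/
def cAY_BC (a b c y : Fin n) : CRel n → Bool := pAnd (lnk [a] [y]) (pAnd (lnk [b] [c]) (sep [a] [b]))
/-- `a|b|cy`. [this work] -/
def cCY (a b c y : Fin n) : CRel n → Bool := pAnd (lnk [c] [y]) (pAnd (sep [a] [b, c]) (sep [b] [c]))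
/-- `a|by|c`. [this work] -/
def cBY (a b c y : Fin n) : CRel n → Bool := pAnd (lnk [b] [y]) (pAnd (sep [a] [b, c]) (sep [b] [c]))
/-- `aby|c`. [this work] -/
def cABY_C (a b c y : Fin n) : CRel n → Bool := pAnd (lnk [a] [b]) (pAnd (lnk [a] [y]) (sep [c] [a]))
/-- `acy|b`. [this work] -/
def cACY_B (a b c y : Fin n) : CRel n → Bool := pAnd (lnk [a] [c]) (pAnd (lnk [a] [y]) (sep [b] [a]))
/-- `a|bcy`. [this work] -/
def cBCY_A (a b c y : Fin n) : CRel n → Bool := pAnd (lnk [b] [c]) (pAnd (lnk [b] [y]) (sep [a] [b]))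

/-! ## The two rows as signed cubic term families (third factor = the sure event) -/

/-- `F11y` as a term family: `μ(abc|y)μ(∅) − μ(ab|c|y)μ(ac|b|y) − μ(ab|c|y)μ(a|bc|y) − μ(ac|b|y)μ(a|bc|y)`. [this work] -/
def f11Terms (n : ℕ) (x : Quad n) : List (CTerm n) :=
  let a := x.1
  let b := x.2.1
  let c := x.2.2.1
  let y := x.2.2.2
  [(1, cABC_Y a b c y, cNone a b c y, pTrue), (-1, cAB a b c y, cAC a b c y, pTrue), (-1, cAB a b c y, cBC a b c y, pTrue),
    (-1, cAC a b c y, cBC a b c y, pTrue)]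

/-- `2·Q44` as a term family (integer coefficients `2, −2, −1`). [this work] -/
def q44Terms (n : ℕ) (x : Quad n) : List (CTerm n) :=
  let a := x.1
  let b := x.2.1
  let c := x.2.2.1
  let y := x.2.2.2
  [(2, cAll a b c y, cNone a b c y, pTrue), (2, cAB_CY a b c y, cNone a b c y, pTrue),
    (-2, cAB_CY a b c y, cAC_BY a b c y, pTrue), (-2, cAB_CY a b c y, cAY_BC a b c y, pTrue), (-2, cAB a b c y, cAY_BC a b c y, pTrue),
    (-2, cAB a b c y, cCY a b c y, pTrue), (-2, cAY_BC a b c y, cCY a b c y, pTrue),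
    (-1, cABC_Y a b c y, cBY a b c y, pTrue), (-1, cABC_Y a b c y, cCY a b c y, pTrue), (-1, cABY_C a b c y, cAC a b c y, pTrue),
    (-1, cABY_C a b c y, cCY a b c y, pTrue), (-1, cAB a b c y, cACY_B a b c y, pTrue), (-1, cAB a b c y, cBCY_A a b c y, pTrue),
    (-1, cACY_B a b c y, cBY a b c y, pTrue), (-1, cAC a b c y, cBCY_A a b c y, pTrue)]

/-- `f11Terms` commutes with vertex relabellings. [this work] -/
theorem f11Terms_equivariant : QuadEquivariant f11Terms := by
  intro n τ x
  obtain ⟨a, b, c, y⟩ := x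
  rfl

/-- `q44Terms` commutes with vertex relabellings. [this work] -/
theorem q44Terms_equivariant : QuadEquivariant q44Terms := by
  intro n τ x
  obtain ⟨a, b, c, y⟩ := x
  rfl

/-- `K₄` check of `F11y` (base `2^23`). [this work] -/
theorem f11Check4 : checkC 4 23 (f11Terms 4 (quad₀ 4 le_rfl)) = true := by native_decide
/-- `K₅` check of `F11y` (base `2^35`). [this work] -/
theorem f11Check5 : checkC 5 35 (f11Terms 5 (quad₀ 5 (by norm_num))) = true := by native_decide
/-- `K₄` check of `Q44` (base `2^24`: the coefficient bound `sabs·8^m < 2^(σ-1)` needs one more bit than the `E₃` rows). [this work] -/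
theorem q44Check4 : checkC 4 24 (q44Terms 4 (quad₀ 4 le_rfl)) = true := by native_decide
/-- `K₅` check of `Q44` (base `2^36`). [this work] -/
theorem q44Check5 : checkC 5 36 (q44Terms 5 (quad₀ 5 (by norm_num))) = true := by native_decide

/-- **`F11y` (term form) on every weighted graph with at most five vertices.** [this work] -/
theorem f11_le_five : ∀ n ≤ 5, ∀ (w : Sym2 (Fin n) → unitInterval) (a b c y : Fin n),
    a ≠ b → a ≠ c → a ≠ y → b ≠ c → b ≠ y → c ≠ y → 0 ≤ cval w (f11Terms n (a, b, c, y)) :=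
  quad_cval_le_five f11Terms_equivariant f11Check4 f11Check5

/-- **`Q44` (term form) on every weighted graph with at most five vertices.** [this work] -/
theorem q44_le_five : ∀ n ≤ 5, ∀ (w : Sym2 (Fin n) → unitInterval) (a b c y : Fin n),
    a ≠ b → a ≠ c → a ≠ y → b ≠ c → b ≠ y → c ≠ y → 0 ≤ cval w (q44Terms n (a, b, c, y)) :=
  quad_cval_le_five q44Terms_equivariant q44Check4 q44Check5

/-- **The spectator-triangle row `F11y` on ≤ 5 vertices, probability form**: with `μ = prodBernoulli w` and `μ(P)` the probability of the cell event `P`,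
`μ(ab|c|y)μ(ac|b|y) + μ(ab|c|y)μ(a|bc|y) + μ(ac|b|y)μ(a|bc|y) ≤ μ(abc|y)μ(a|b|c|y)`. [this work] -/
theorem spectatorTriangle_le_five (hn : n ≤ 5) (w : Sym2 (Fin n) → unitInterval) (a b c y : Fin n) (hab : a ≠ b) (hac : a ≠ c)
    (hay : a ≠ y) (hbc : b ≠ c) (hby : b ≠ y) (hcy : c ≠ y) :
    pr w (cAB a b c y) * pr w (cAC a b c y) + pr w (cAB a b c y) * pr w (cBC a b c y) + pr w (cAC a b c y) * pr w (cBC a b c y) ≤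
      pr w (cABC_Y a b c y) * pr w (cNone a b c y) := by
  have h := f11_le_five n hn w a b c y hab hac hay hbc hby hcy
  unfold f11Terms cval at h
  simp only [List.map_cons, List.map_nil, List.sum_cons, List.sum_nil, pr_pTrue] at h
  push_cast at h
  linarith

/-- **The row `Q44` on ≤ 5 vertices, probability form** (the fifteen products listed in `q44Terms`, divided by two). [this work] -/
theorem q44_pr_le_five (hn : n ≤ 5) (w : Sym2 (Fin n) → unitInterval) (a b c y : Fin n) (hab : a ≠ b) (hac : a ≠ c)
    (hay : a ≠ y) (hbc : b ≠ c) (hby : b ≠ y) (hcy : c ≠ y) :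
    pr w (cAB_CY a b c y) * pr w (cAC_BY a b c y) + pr w (cAB_CY a b c y) * pr w (cAY_BC a b c y) + pr w (cAB a b c y) * pr w (cAY_BC a b c y) +
          pr w (cAB a b c y) * pr w (cCY a b c y) + pr w (cAY_BC a b c y) * pr w (cCY a b c y) +
        (pr w (cABC_Y a b c y) * pr w (cBY a b c y) + pr w (cABC_Y a b c y) * pr w (cCY a b c y) + pr w (cABY_C a b c y) * pr w (cAC a b c y) +
              pr w (cABY_C a b c y) * pr w (cCY a b c y) + pr w (cAB a b c y) * pr w (cACY_B a b c y) + pr w (cAB a b c y) * pr w (cBCY_A a b c y) +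
            pr w (cACY_B a b c y) * pr w (cBY a b c y) + pr w (cAC a b c y) * pr w (cBCY_A a b c y)) / 2 ≤
      pr w (cAll a b c y) * pr w (cNone a b c y) + pr w (cAB_CY a b c y) * pr w (cNone a b c y) := by
  have h := q44_le_five n hn w a b c y hab hac hay hbc hby hcy
  unfold q44Terms cval at h
  simp only [List.map_cons, List.map_nil, List.sum_cons, List.sum_nil, pr_pTrue] at h
  push_cast at h
  linarith

end Summit.CriticalPhenomena.PercolationContinuityZ3.Theorems.SpectatorTriangleRow
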